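import Summits.QuantumFields.GaugeBoot.ClassB
import Literature.MathematicalPhysics.QuantumFieldTheory.LatticeGaugeShenZhuZhuProofs
import HarnessLib

/-!
# Torus limit points are one-link Gibbs (Haar-shift) states (gauge-boot, Class-B identification brick)

HONEST FRAMING (cell `pub-gaugeboot`, page 1 of every file): the venture produces certified bounds
on lattice expectations at stated coupling, gauge group, dimension and torus size; NOT a mass gap,
NOT a continuum limit, NOT a string tension; NOT Yang–Mills-summit-bearing (barriers
`FixedCouplingUltralocality`, `PerturbativeInvisibility`).

`ClassB.lean` lists the properties a loop-equation SDP with all three reflection-positivity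
families consumes (`ClassBState`) and leaves the identification `ThermodynamicLimitIsClassB` of the
physically constructed states with that class OPEN. This file discharges ONE field of the
identification for every infinite-volume DLR state, in particular for every infinite-volume limit
point of the torus Wilson states: the one-link Gibbs (Haar-shift) identity `IsHaarShiftState ρ β μ`
— the axiom from which the loop (Schwinger–Dyson) equations of Class B are read off.

* `integral_shift_ymSpecification_singleton` — the identity for the ONE-LINK kernel
  `γ_{e}(· | η) = ymSpecification ρ β {e} η` (Haar measure on `U_e` tilted by `exp(-β S_e)`, the
  other links frozen to `η`): for measurable `f` and `g ∈ G`,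
  `∫ f(U[e ↦ g U_e]) dγ_{e}(U | η) = ∫ f(U) exp(-β (S_e(U[e ↦ g⁻¹ U_e]) - S_e(U))) dγ_{e}(U | η)`
  (left invariance of Haar measure: substitute `U_e ↦ g⁻¹ U_e` in the tilting density);
* `isHaarShiftState_of_mem_ymGibbsMeasures` — every DLR state `μ ∈ 𝒢(β)` of the lattice
  Yang–Mills specification is a Haar-shift state: integrate the one-link identity against `μ` and
  use the DLR equation for observables (`IsGibbsMeasure.integral_integral_eq`, Georgii 2011
  (1.21)/(1.26)) on both sides;
* `isHaarShiftState_of_mem_infiniteVolumeLimitPoints` — every torus limit point is a Haar-shift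
  state (limit points are DLR: `mem_ymGibbsMeasures_of_mem_infiniteVolumeLimitPoints_holds`,
  Georgii Thm. 4.17 in the tree).

With the tree's `isZdTranslationInvariant_of_mem_infiniteVolumeLimitPoints` this gives two of the
seven `ClassBState` fields for torus limit points; site/link RP, hyperoctahedral invariance and —
the open one — diagonal RP remain (`TorusLimitPointsDiagonalRP`). No claim beyond that is made.

References: H.-O. Georgii, Gibbs Measures and Phase Transitions (2011), Def. 1.23, (1.26), Def. 2.9,
Thm. 4.17; E. Seiler, LNP 159 (1982) Ch. 2 (the one-link DLR equation of lattice gauge theory).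
-/

noncomputable section

open MeasureTheory
open Literature.Probability.LatticeModels (glueWith glueWith_apply_mem glueWith_apply_not_mem
  measurable_glueWith IsGibbsMeasure)
open Literature.MathematicalPhysics.QuantumLattice
open Literature.MathematicalPhysics.QuantumFieldTheory (haarProbability
  isSpecification_ymSpecification_of_t2Space)

namespace Summit.QuantumFields.GaugeBoot

variable {d N : ℕ} {G : Type*} [Group G] [TopologicalSpace G] [IsTopologicalGroup G]
  [CompactSpace G] [MeasurableSpace G] [BorelSpace G] [SecondCountableTopology G]
variable (ρ : G →* Matrix (Fin N) (Fin N) ℂ)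

/-! ## One-link configurations -/

section OneLink

variable (e : ZdEdge d)

omit [Group G] [TopologicalSpace G] [IsTopologicalGroup G] [CompactSpace G] [MeasurableSpace G]
  [BorelSpace G] [SecondCountableTopology G] in
/-- Gluing on the single link `e` is updating the link `e`. -/
theorem glueWith_singleton (ζ : ↥({e} : Finset (ZdEdge d)) → G) (η : LGConfig d G) :
    glueWith {e} ζ η = Function.update η e (ζ ⟨e, Finset.mem_singleton_self e⟩) := by
  funext x
  by_cases hx : x = e
  · subst hx
    rw [glueWith_apply_mem _ _ _ (Finset.mem_singleton_self _), Function.update_self]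
  · rw [glueWith_apply_not_mem _ _ _ (by simpa using hx), Function.update_of_ne hx]

omit [TopologicalSpace G] [IsTopologicalGroup G] [CompactSpace G] [MeasurableSpace G] [BorelSpace G]
  [SecondCountableTopology G] in
/-- Shifting the link `e` of a glued one-link configuration by `g` is gluing the shifted value. -/
theorem update_glueWith_singleton (g : G) (ζ : ↥({e} : Finset (ZdEdge d)) → G) (η : LGConfig d G) :
    Function.update (glueWith {e} ζ η) e (g * glueWith {e} ζ η e) =
      glueWith {e} (fun x => g * ζ x) η := by
  rw [glueWith_singleton, glueWith_singleton, Function.update_self, Function.update_idem]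

omit [SecondCountableTopology G] in
/-- Left multiplication of the single link variable preserves the product Haar measure on
`{e} → G`. -/
theorem measurePreserving_mul_left_singleton (g : G) :
    MeasurePreserving (fun ζ : ↥({e} : Finset (ZdEdge d)) → G => fun x => g * ζ x)
      (Measure.pi fun _ => haarProbability G) (Measure.pi fun _ => haarProbability G) :=
  measurePreserving_pi _ _ fun _ => measurePreserving_mul_left (haarProbability G) g

omit [CompactSpace G] in
/-- The one-link shift `U ↦ U[e ↦ g U_e]` is measurable. -/
theorem measurable_update_mul (g : G) :
    Measurable fun U : LGConfig d G => Function.update U e (g * U e) := by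
  refine measurable_pi_iff.2 fun x => ?_
  by_cases hx : x = e
  · subst hx
    simp only [Function.update_self]
    have hx : Measurable fun U : LGConfig d G => U x := measurable_pi_apply x
    exact measurable_const.mul hx
  · simp only [Function.update_of_ne hx]
    exact measurable_pi_apply x

omit [CompactSpace G] [MeasurableSpace G] [BorelSpace G] [SecondCountableTopology G] in
/-- The one-link shift `U ↦ U[e ↦ g U_e]` is continuous. -/
theorem continuous_update_mul (g : G) :
    Continuous fun U : LGConfig d G => Function.update U e (g * U e) := by
  refine continuous_pi fun x => ?_
  by_cases hx : x = e
  · subst hx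
    simp only [Function.update_self]
    have hx : Continuous fun U : LGConfig d G => U x := continuous_apply x
    exact continuous_const.mul hx
  · simp only [Function.update_of_ne hx]
    exact continuous_apply x

/-- **The Haar-shift identity for the one-link kernel** `γ_{e}(· | η)`: for measurable `f` and
`g ∈ G`, `∫ f(U[e ↦ g U_e]) dγ_{e}(U | η) = ∫ f(U) exp(-β (S_e(U[e ↦ g⁻¹ U_e]) - S_e(U))) dγ_{e}(U | η)`,
`S_e = wilsonBoundaryAction ρ {e}` (left invariance of the Haar measure of the link `e`). -/
theorem integral_shift_ymSpecification_singleton (hρ : Continuous ρ) (β : ℝ) (g : G)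
    (η : LGConfig d G) {f : LGConfig d G → ℝ} (hf : Measurable f) :
    ∫ U, f (Function.update U e (g * U e)) ∂(ymSpecification ρ β {e} η) =
      ∫ U, f U * Real.exp (-(β * (wilsonBoundaryAction ρ {e} (Function.update U e (g⁻¹ * U e)) -
        wilsonBoundaryAction ρ {e} U))) ∂(ymSpecification ρ β {e} η) := by
  have hS : Continuous (wilsonBoundaryAction (G := G) ρ {e}) := continuous_wilsonBoundaryAction ρ hρ _
  have hd : Measurable fun U : LGConfig d G =>
      wilsonBoundaryAction ρ {e} (Function.update U e (g⁻¹ * U e)) - wilsonBoundaryAction ρ {e} U :=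
    ((hS.comp (continuous_update_mul e g⁻¹)).sub hS).measurable
  have hr : Measurable fun U : LGConfig d G => f U * Real.exp (-(β *
      (wilsonBoundaryAction ρ {e} (Function.update U e (g⁻¹ * U e)) - wilsonBoundaryAction ρ {e} U))) :=
    hf.mul (Real.measurable_exp.comp (hd.const_mul β).neg)
  rw [integral_ymSpecification ρ hρ β {e} (F := fun U => f (Function.update U e (g * U e)))
      (hf.comp (measurable_update_mul e g)) η, integral_ymSpecification ρ hρ β {e} hr η]
  congr 1
  -- the common value: `Φ(ζ') = f(ζ' η) exp(-β S_e((g⁻¹ ζ') η))`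
  set Φ : (↥({e} : Finset (ZdEdge d)) → G) → ℝ := fun ζ' => f (glueWith {e} ζ' η) *
    Real.exp (-β * wilsonBoundaryAction ρ {e} (glueWith {e} (fun x => g⁻¹ * ζ' x) η)) with hΦ
  have hmul : Measurable fun ζ' : ↥({e} : Finset (ZdEdge d)) → G => fun x => g⁻¹ * ζ' x :=
    measurable_pi_lambda _ fun x => measurable_const.mul (measurable_pi_apply x)
  have hΦm : Measurable Φ :=
    (hf.comp (measurable_glueWith _ η)).mul (Real.measurable_exp.comp
      ((hS.measurable.comp ((measurable_glueWith _ η).comp hmul)).const_mul _))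
  have hL : ∀ ζ : ↥({e} : Finset (ZdEdge d)) → G,
      f (Function.update (glueWith {e} ζ η) e (g * glueWith {e} ζ η e)) *
        Real.exp (-β * wilsonBoundaryAction ρ {e} (glueWith {e} ζ η)) = Φ (fun x => g * ζ x) := by
    intro ζ
    simp only [hΦ, update_glueWith_singleton, inv_mul_cancel_left]
  have hR : ∀ ζ : ↥({e} : Finset (ZdEdge d)) → G,
      f (glueWith {e} ζ η) * Real.exp (-(β * (wilsonBoundaryAction ρ {e}
        (Function.update (glueWith {e} ζ η) e (g⁻¹ * glueWith {e} ζ η e)) -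
          wilsonBoundaryAction ρ {e} (glueWith {e} ζ η)))) *
        Real.exp (-β * wilsonBoundaryAction ρ {e} (glueWith {e} ζ η)) = Φ ζ := by
    intro ζ
    simp only [hΦ, update_glueWith_singleton]
    rw [mul_assoc, ← Real.exp_add]
    congr 2
    ring
  simp_rw [hL, hR]
  rw [← integral_map (measurePreserving_mul_left_singleton e g).measurable.aemeasurable
      hΦm.aestronglyMeasurable, (measurePreserving_mul_left_singleton e g).map_eq]

end OneLink

/-! ## DLR states and torus limit points are Haar-shift states -/

section HaarShift

variable [T2Space G]

/-- **Every infinite-volume DLR state of lattice Yang–Mills theory is a one-link Gibbs (Haar-shift)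
state**: `μ ∈ 𝒢(β) ⇒ IsHaarShiftState ρ β μ` (Georgii 2011, Def. 1.23 with (1.26): integrate the
one-link identity `integral_shift_ymSpecification_singleton` against `μ` and apply the DLR
equation for observables to both sides). -/
theorem isHaarShiftState_of_mem_ymGibbsMeasures (hρ : Continuous ρ) {β : ℝ}
    {μ : Measure (LGConfig d G)} (hμ : μ ∈ ymGibbsMeasures ρ β) : IsHaarShiftState ρ β μ := by
  intro e g f S _ hfc
  have hγ := isSpecification_ymSpecification_of_t2Space (d := d) ρ hρ β
  have hG : IsGibbsMeasure (ymSpecification ρ β) μ := hμ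
  haveI := hG.isProbabilityMeasure
  have hS : Continuous (wilsonBoundaryAction (G := G) ρ {e}) := continuous_wilsonBoundaryAction ρ hρ _
  obtain ⟨Cf, hCf⟩ := exists_bound_of_continuous hfc
  have hwc : Continuous fun U : LGConfig d G => Real.exp (-(β *
      (wilsonBoundaryAction ρ {e} (Function.update U e (g⁻¹ * U e)) - wilsonBoundaryAction ρ {e} U))) :=
    Real.continuous_exp.comp ((((hS.comp (continuous_update_mul e g⁻¹)).sub hS).const_smul β).neg)
  obtain ⟨Cw, hCw⟩ := exists_bound_of_continuous hwc
  have h1 : Integrable (fun U : LGConfig d G => f (Function.update U e (g * U e))) μ :=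
    integrable_of_bound (hfc.comp (continuous_update_mul e g)).aestronglyMeasurable fun U => hCf _
  have h2 : Integrable (fun U : LGConfig d G => f U * Real.exp (-(β *
      (wilsonBoundaryAction ρ {e} (Function.update U e (g⁻¹ * U e)) -
        wilsonBoundaryAction ρ {e} U)))) μ :=
    integrable_of_bound (hfc.mul hwc).aestronglyMeasurable (C := Cf * Cw) fun U => by
      rw [abs_mul]
      exact mul_le_mul (hCf U) (hCw U) (abs_nonneg _) ((abs_nonneg _).trans (hCf U))
  rw [← IsGibbsMeasure.integral_integral_eq hγ hG {e} h1, ← IsGibbsMeasure.integral_integral_eq hγ hG {e} h2]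
  exact integral_congr_ae (ae_of_all _ fun η =>
    integral_shift_ymSpecification_singleton ρ e hρ β g η hfc.measurable)

/-- **Every infinite-volume limit point of the torus Wilson states is a Haar-shift state** — the
`haarShift` field of `ClassBState` holds for torus limit points (they are DLR states, Georgii
Thm. 4.17: `mem_ymGibbsMeasures_of_mem_infiniteVolumeLimitPoints_holds`). -/
theorem isHaarShiftState_of_mem_infiniteVolumeLimitPoints (hρ : Continuous ρ) {β : ℝ}
    {μ : Measure (LGConfig d G)} (hμ : μ ∈ infiniteVolumeLimitPoints (d := d) ρ β) :
    IsHaarShiftState ρ β μ :=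
  isHaarShiftState_of_mem_ymGibbsMeasures ρ hρ
    (mem_ymGibbsMeasures_of_mem_infiniteVolumeLimitPoints_holds ρ hρ hμ)

end HaarShift

end Summit.QuantumFields.GaugeBoot
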